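import Summits.KontsevichZagierPeriods.KontsevichZagierPeriods.Theorems.EllipticMomentKernel.Negative.LoadBearing

/-!
# `EllipticMomentKernel` (stmt-KontsevichZagierPeriods-10631) — negative knowledge, part 2: the Newton–Leibniz-free sub-calculus

The additive invariant `dimEval d : FormalRep →+ ℝ` (value of the dimension-`d` part) is killed by
the moves (1a), (1b), (2) (`noNL_le_ker_dimEval`) and equals `value r` on a Newton–Leibniz move
`[r] − [r']`. Consequence for the crux: every 2-dimensional generator `[D, x^a y^b]` with `a` even
has positive value (`value_pos_of_gens₂`), so it is NOT congruent to any combination of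
1-dimensional generators modulo the sub-calculus generated by (1a), (1b), (2)
(`of_gens₂_sub_not_mem_noNL`): the reduction of moments to the normal form needs rule (3).
[folklore]
-/

noncomputable section

open MeasureTheory Set
open scoped BigOperators

namespace Summit.KontsevichZagierPeriods.HermiteRigidity.EllipticMomentKernelNegative

open Literature.NumberTheory.Transcendental
open Literature.NumberTheory.Transcendental.KZ
open Summit.KontsevichZagierPeriods.KontsevichZagierPeriods.Theses.HermiteRigidity (EllipticMomentKernel)

/-! ## §3 Which moves a derivation must use: the Newton–Leibniz-free sub-calculus -/

section DimEval

variable {n : ℕ}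

/-- Evaluation of the dimension-`d` part only: `[r] ↦ value r` if `r` lives in dimension `d`,
`0` otherwise. Moves (1a), (1b), (2) stay inside one dimension and are sound, so they preserve
every `dimEval d`; a Newton–Leibniz move `[r] − [r']` (`r` in dimension `n + 1`, `r'` in
dimension `n`) has `dimEval (n+1) = value r`. [cite: KontsevichZagier2001, §1.2] -/
def dimEval (d : ℕ) : FormalRep →+ ℝ :=
  FreeAbelianGroup.lift fun p => if p.1 = d then p.2.value else 0

/-- `dimEval` of a generator. [cite: KontsevichZagier2001, §1.2] -/
@[simp] theorem dimEval_of (d : ℕ) (r : IntegralRep n) :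
    dimEval d (KZ.of r) = if n = d then r.value else 0 :=
  FreeAbelianGroup.lift_apply_of _ _

/-- Domain additivity preserves `dimEval d`. [cite: KontsevichZagier2001, §1.2 rule (1)] -/
theorem dimEval_eq_zero_of_mem_domainAddRel (d : ℕ) {c : FormalRep} (hc : c ∈ domainAddRel) :
    dimEval d c = 0 := by
  have h0 := eval_eq_zero_of_mem_domainAddRel_holds hc
  obtain ⟨n, r, r₁, r₂, -, -, -, -, rfl⟩ := hc
  by_cases h : n = d
  · simp only [map_sub, eval_of] at h0
    simpa [h] using h0
  · simp [h]

/-- Integrand additivity preserves `dimEval d`. [cite: KontsevichZagier2001, §1.2 rule (1)] -/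
theorem dimEval_eq_zero_of_mem_integrandAddRel (d : ℕ) {c : FormalRep}
    (hc : c ∈ integrandAddRel) : dimEval d c = 0 := by
  have h0 := eval_eq_zero_of_mem_integrandAddRel_holds hc
  obtain ⟨n, r, r₁, r₂, -, -, -, rfl⟩ := hc
  by_cases h : n = d
  · simp only [map_sub, eval_of] at h0
    simpa [h] using h0
  · simp [h]

/-- Change of variables preserves `dimEval d`. [cite: KontsevichZagier2001, §1.2 rule (2)] -/
theorem dimEval_eq_zero_of_mem_changeOfVariablesRel (d : ℕ) {c : FormalRep}
    (hc : c ∈ changeOfVariablesRel) : dimEval d c = 0 := by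
  have h0 := eval_eq_zero_of_mem_changeOfVariablesRel_holds hc
  obtain ⟨n, r, r', Φ, Φ', -, -, -, -, -, rfl⟩ := hc
  by_cases h : n = d
  · simp only [map_sub, eval_of] at h0
    simpa [h] using h0
  · simp [h]

/-- A Newton–Leibniz move is detected by `dimEval`: `dimEval (n+1) ([r] − [r']) = value r`.
[cite: KontsevichZagier2001, §1.2 rule (3)] -/
theorem dimEval_succ_of_sub_of (r : IntegralRep (n + 1)) (r' : IntegralRep n) :
    dimEval (n + 1) (KZ.of r - KZ.of r') = r.value := by
  simp

/-- The Newton–Leibniz-free ("scissors + reparametrisation") sub-calculus: the subgroup generated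
by moves (1a), (1b), (2). [cite: KontsevichZagier2001, §1.2] -/
def noNL : AddSubgroup FormalRep :=
  AddSubgroup.closure (domainAddRel ∪ integrandAddRel ∪ changeOfVariablesRel)

/-- `noNL ≤ relations`. [cite: KontsevichZagier2001, §1.2] -/
theorem noNL_le_relations : noNL ≤ relations :=
  AddSubgroup.closure_mono fun _ hc => Or.inl hc

/-- **Moves (1a) + (1b) + (2) preserve every `dimEval d`.** [cite: KontsevichZagier2001, §1.2] -/
theorem noNL_le_ker_dimEval (d : ℕ) : noNL ≤ (dimEval d).ker := by
  refine (AddSubgroup.closure_le _).mpr ?_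
  rintro c ((hc | hc) | hc)
  · exact dimEval_eq_zero_of_mem_domainAddRel d hc
  · exact dimEval_eq_zero_of_mem_integrandAddRel d hc
  · exact dimEval_eq_zero_of_mem_changeOfVariablesRel d hc

end DimEval


section Moments

variable {q₂ q₃ : ℚ}

/-- The region `D` under the graph is open. [folklore] -/
theorem isOpen_underGraph : IsOpen (underGraph q₂ q₃) := by
  have h1 : IsOpen {p : Fin 2 → ℝ | 0 < cubic q₂ q₃ (p 0)} :=
    isOpen_lt continuous_const (continuous_cubic.comp (continuous_apply 0))
  have h2 : IsOpen {p : Fin 2 → ℝ | ∃ t : ℝ, p 0 < t ∧ cubic q₂ q₃ t < 0} := by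
    rw [Set.setOf_exists]
    exact isOpen_iUnion fun t => by
      by_cases hft : cubic q₂ q₃ t < 0
      · simpa [hft] using isOpen_lt (continuous_apply 0) continuous_const
      · simp [hft]
  have h3 : IsOpen {p : Fin 2 → ℝ | 0 < p 1} := isOpen_lt continuous_const (continuous_apply 1)
  have h4 : IsOpen {p : Fin 2 → ℝ | p 1 ^ 2 < cubic q₂ q₃ (p 0)} :=
    isOpen_lt ((continuous_apply 1).pow 2) (continuous_cubic.comp (continuous_apply 0))
  have : underGraph q₂ q₃ = ({p | 0 < cubic q₂ q₃ (p 0)} ∩ {p | ∃ t : ℝ, p 0 < t ∧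
      cubic q₂ q₃ t < 0}) ∩ {p | 0 < p 1} ∩ {p : Fin 2 → ℝ | p 1 ^ 2 < cubic q₂ q₃ (p 0)} := by
    ext p; simp only [underGraph, mem_setOf_eq, mem_inter_iff]; tauto
  rw [this]
  exact ((h1.inter h2).inter h3).inter h4

/-- An explicit point of `D` off the axis `x = 0` when `disc > 0`:
`(−m, √f(−m)/2)`, `m = √(q₂/12)`. [folklore] -/
theorem exists_mem_underGraph_ne_zero (h : 0 < disc q₂ q₃) :
    ∃ p ∈ underGraph q₂ q₃, p 0 ≠ 0 := by
  have hm := neg_sqrt_mem_oval (q₃ := q₃) h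
  obtain ⟨hpos, t, ht, hft⟩ := hm
  set m := Real.sqrt (q₂ / 12) with hm_def
  have hdisc := h
  unfold disc at hdisc
  have hq : (0 : ℝ) < q₂ := by
    by_contra hle
    push Not at hle
    have h3 : (q₂ : ℝ) ^ 3 ≤ 0 := by
      have : (q₂ : ℝ) ^ 3 = q₂ * q₂ ^ 2 := by ring
      rw [this]; exact mul_nonpos_of_nonpos_of_nonneg hle (sq_nonneg _)
    nlinarith [sq_nonneg (q₃ : ℝ)]
  have hm0 : 0 < m := Real.sqrt_pos.2 (by positivity)
  set y := Real.sqrt (cubic q₂ q₃ (-m)) / 2 with hy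
  have hy0 : 0 < y := by positivity
  have hy2 : y ^ 2 < cubic q₂ q₃ (-m) := by
    have : y ^ 2 = cubic q₂ q₃ (-m) / 4 := by
      rw [hy, div_pow, Real.sq_sqrt hpos.le]; norm_num
    rw [this]; linarith
  refine ⟨![-m, y], ⟨⟨?_, t, ?_, hft⟩, ?_, ?_⟩, ?_⟩
  · simpa using hpos
  · simpa using ht
  · simpa using hy0
  · simpa using hy2
  · simp [hm0.ne']

/-- **Every 2-dimensional generator `[D, x^a y^b]` with `a` even has strictly positive value**
(the integrand is `≥ 0` on the open set `D` and `> 0` on `D ∩ {x ≠ 0} ≠ ∅`). [folklore] -/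
theorem value_pos_of_gens₂ (hd : 0 < disc q₂ q₃) {r : IntegralRep 2} {a b : ℕ} (ha : Even a)
    (hdom : r.domain = underGraph q₂ q₃)
    (hint : EqOn r.integrand (fun p => p 0 ^ a * p 1 ^ b) (underGraph q₂ q₃)) :
    0 < r.value := by
  have hmeas : MeasurableSet (underGraph q₂ q₃) := isOpen_underGraph.measurableSet
  have hri : IntegrableOn (fun p : Fin 2 → ℝ => p 0 ^ a * p 1 ^ b) (underGraph q₂ q₃) :=
    (hdom ▸ r.integrableOn).congr_fun hint hmeas
  unfold IntegralRep.value
  rw [hdom, setIntegral_congr_fun hmeas hint]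
  have hnn : 0 ≤ᵐ[volume.restrict (underGraph q₂ q₃)] fun p : Fin 2 → ℝ => p 0 ^ a * p 1 ^ b := by
    refine ae_restrict_of_forall_mem hmeas fun p hp => ?_
    exact mul_nonneg (ha.pow_nonneg _) (pow_nonneg hp.2.1.le _)
  rw [setIntegral_pos_iff_support_of_nonneg_ae hnn hri]
  obtain ⟨p₀, hp₀, hp₀0⟩ := exists_mem_underGraph_ne_zero (q₃ := q₃) hd
  have hsub : underGraph q₂ q₃ ∩ {p | p 0 ≠ 0} ⊆
      Function.support (fun p : Fin 2 → ℝ => p 0 ^ a * p 1 ^ b) ∩ underGraph q₂ q₃ := by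
    intro p hp
    refine ⟨?_, hp.1⟩
    rw [Function.mem_support]
    exact mul_ne_zero (pow_ne_zero _ hp.2) (pow_ne_zero _ hp.1.2.1.ne')
  refine lt_of_lt_of_le ?_ (measure_mono hsub)
  have hopen : IsOpen (underGraph q₂ q₃ ∩ {p : Fin 2 → ℝ | p 0 ≠ 0}) :=
    isOpen_underGraph.inter (isOpen_ne_fun (continuous_apply 0) continuous_const)
  exact hopen.measure_pos volume ⟨p₀, hp₀, hp₀0⟩

/-- `dimEval 2` kills every combination of 1-dimensional generators. [folklore] -/
theorem dimEval_two_eq_zero_of_mem_closure_gens₁ {c : FormalRep}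
    (hc : c ∈ AddSubgroup.closure (gens₁ q₂ q₃)) : dimEval 2 c = 0 := by
  induction hc using AddSubgroup.closure_induction with
  | mem x hx =>
    obtain ⟨r, m, -, -, rfl⟩ := hx
    simp
  | zero => simp
  | add x y _ _ hx hy => simp [hx, hy]
  | neg x _ hx => simp [hx]

/-- **The reduction of a moment to the 1-dimensional normal form NEEDS a Newton–Leibniz move**:
for `a` even, `[D, x^a y^b] − c ∉ noNL` for every combination `c` of the 1-dimensional
generators (`dimEval 2` is `value [D, x^a y^b] > 0` on the left, `0` on `noNL`). In particular
the crux is not a statement of the scissors sub-calculus: any proof must instantiate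
`KZ.newtonLeibnizRel` (the route's "rule 3 along `y`"). [folklore] -/
theorem of_gens₂_sub_not_mem_noNL (hd : 0 < disc q₂ q₃) {r : IntegralRep 2} {a b : ℕ}
    (ha : Even a) (hdom : r.domain = underGraph q₂ q₃)
    (hint : EqOn r.integrand (fun p => p 0 ^ a * p 1 ^ b) (underGraph q₂ q₃))
    {c : FormalRep} (hc : c ∈ AddSubgroup.closure (gens₁ q₂ q₃)) :
    KZ.of r - c ∉ noNL := by
  intro h
  have hk := noNL_le_ker_dimEval 2 h
  rw [AddMonoidHom.mem_ker, map_sub, dimEval_two_eq_zero_of_mem_closure_gens₁ hc,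
    dimEval_of] at hk
  simp only [if_true, sub_zero] at hk
  exact (value_pos_of_gens₂ hd ha hdom hint).ne' hk

/-- Kernel-level form: a value-`0` combination whose 2-dimensional part has non-zero value is
not derivable without Newton–Leibniz. [folklore] -/
theorem not_mem_noNL_of_dimEval_ne_zero {c : FormalRep} {d : ℕ} (h : dimEval d c ≠ 0) :
    c ∉ noNL := fun hc => h (noNL_le_ker_dimEval d hc)

end Moments

end Summit.KontsevichZagierPeriods.HermiteRigidity.EllipticMomentKernelNegative
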